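import Mathlib.NumberTheory.LegendreSymbol.JacobiSymbol
import Mathlib.NumberTheory.LegendreSymbol.QuadraticChar.Basic
import Mathlib.NumberTheory.DirichletCharacter.Basic
import Literature.NumberTheory.LFunctions.PrimitiveQuadraticCharacter
import HarnessLib

/-!
# The Jacobi symbol `n ↦ (n / q)` as a Dirichlet character, and the Kronecker symbol of an odd
# fundamental discriminant

Topic `NumberTheory/QuadraticFields` (namespace `Literature.NumberTheory.QuadraticFields`).
Everything here is PROVED (one definition with its API, theorems; no named facts).

For `q ≥ 1`, Mathlib's Jacobi symbol `J(a | q)` is completely multiplicative and `q`-periodic in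
`a` and vanishes exactly when `gcd(a, q) ≠ 1` (`jacobiSym.mul_left`, `jacobiSym.mod_left`,
`jacobiSym.eq_zero_iff_not_coprime`), so it is a Dirichlet character modulo `q`; Mathlib does
not bundle it (searched `jacobiSym` with `MulChar`/`DirichletCharacter`; it has `legendreSym.hom`
in the *top* argument only for prime modulus, as `quadraticChar`). We define

* `jacobiChar q : DirichletCharacter ℂ q`, `jacobiChar q n = J(n | q)` (`jacobiChar_natCast`,
  `jacobiChar_intCast`), with values in `{0, 1, −1}` (`jacobiChar_trichotomy`) and
  `jacobiChar q ≠ 1` for `q` odd, square-free, `≠ 1` (`jacobiChar_ne_one`);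

and prove that for an **odd fundamental discriminant** `D` (`D ≡ 1 (mod 4)`; `q = |D|`) it is the
Kronecker symbol `(D / ·)` of the quadratic field of discriminant `D` (Cox, *Primes of the form
x² + ny²*, §1.C, Lemma 1.14 — the unique homomorphism `χ : (ℤ/Dℤ)* → {±1}` with `χ([p]) = (D/p)`
for odd primes `p ∤ D` — and its proof via the Jacobi symbol, (1.15)–(1.18), PDF p. 43 of the held
copy; Davenport, *Multiplicative Number Theory*, Ch. 5):

* `jacobiSym_natAbs_eq_of_emod_four_eq_one` — `J(p | |D|) = J(D | p)` for odd `p`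
  (quadratic reciprocity in the two cases `D = q ≡ 1 (mod 4)`, `D = −q`, `q ≡ 3 (mod 4)`);
* `jacobiSym_two_natAbs_eq_one_iff`, `jacobiSym_two_natAbs_eq_neg_one_iff` — `J(2 | |D|) = 1 ↔
  D ≡ 1 (mod 8)` and `= −1 ↔ D ≡ 5 (mod 8)` (the supplement `J(2 | q) = χ₈(q)`).

These are the values matched against the decomposition law of `QuadraticFields/KroneckerSplitting.lean`
in `QuadraticDedekindZeta.lean` (`ζ_K = ζ · L(χ_{d_K})`).

## References

* [Cox2013] D. A. Cox, *Primes of the form x² + ny²*, 2nd ed. (2013), §1.C Lemma 1.14 and its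
  proof, (1.15)–(1.18) (PDF p. 43 of the held copy `doi:10.1002/9781118400722`).
* H. Davenport, *Multiplicative Number Theory*, 3rd ed., GTM 74 (2000), Ch. 5 (Kronecker symbol
  of a fundamental discriminant as a primitive real character).
-/

noncomputable section

open scoped NumberTheorySymbols

namespace Literature.NumberTheory.QuadraticFields

/-! ### The Jacobi symbol as a Dirichlet character -/

/-- `J(a | q)` only depends on `a mod q`, in the form needed for `ZMod.val`. [folklore] -/
theorem jacobiSym_natCast_mod (a q : ℕ) : J(((a % q : ℕ) : ℤ) | q) = J((a : ℤ) | q) := by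
  rw [jacobiSym.mod_left (a : ℤ) q, Int.natCast_mod]

/-- **The Jacobi symbol `a ↦ (a / q)` as a Dirichlet character modulo `q`** (values in `ℂ`).
[cite: Cox2013, §1.C Lemma 1.14 (proof, (1.15)–(1.16))] -/
def jacobiChar (q : ℕ) [NeZero q] : DirichletCharacter ℂ q where
  toFun a := (J((a.val : ℤ) | q) : ℂ)
  map_one' := by
    rw [ZMod.val_one_eq_one_mod, jacobiSym_natCast_mod, Nat.cast_one, jacobiSym.one_left,
      Int.cast_one]
  map_mul' a b := by
    rw [ZMod.val_mul, jacobiSym_natCast_mod, Nat.cast_mul, jacobiSym.mul_left, Int.cast_mul]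
  map_nonunit' a ha := by
    have hval : ¬ a.val.Coprime q := fun h => ha (by
      rw [← ZMod.natCast_zmod_val a]
      exact (ZMod.isUnit_iff_coprime a.val q).mpr h)
    have h0 : J((a.val : ℤ) | q) = 0 := by
      rw [jacobiSym.eq_zero_iff_not_coprime, Int.gcd_natCast_natCast]
      exact hval
    rw [h0, Int.cast_zero]

variable {q : ℕ} [NeZero q]

/-- Unfolding on `ZMod q`. [folklore] -/
theorem jacobiChar_apply (a : ZMod q) : jacobiChar q a = (J((a.val : ℤ) | q) : ℂ) := rfl

/-- `jacobiChar q n = J(n | q)` for `n : ℕ`. [folklore] -/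
theorem jacobiChar_natCast (n : ℕ) : jacobiChar q n = (J((n : ℤ) | q) : ℂ) := by
  rw [jacobiChar_apply, ZMod.val_natCast, jacobiSym_natCast_mod]

/-- `jacobiChar q n = J(n | q)` for `n : ℤ`. [folklore] -/
theorem jacobiChar_intCast (n : ℤ) : jacobiChar q n = (J(n | q) : ℂ) := by
  have h0 : 0 ≤ n % (q : ℤ) := Int.emod_nonneg _ (by exact_mod_cast NeZero.ne q)
  have h1 : ((n % (q : ℤ)).toNat : ℤ) = n % (q : ℤ) := Int.toNat_of_nonneg h0
  rw [← ZMod.intCast_mod n q, ← h1, Int.cast_natCast, jacobiChar_natCast, h1, ← jacobiSym.mod_left]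

/-- The values of `jacobiChar` are `0`, `1` or `−1`. [folklore] -/
theorem jacobiChar_trichotomy (a : ZMod q) :
    jacobiChar q a = 0 ∨ jacobiChar q a = 1 ∨ jacobiChar q a = -1 := by
  rw [jacobiChar_apply]
  rcases jacobiSym.trichotomy (a.val : ℤ) q with h | h | h <;> rw [h] <;> norm_num

/-- `jacobiChar q p = 0` for a prime `p ∣ q`. [folklore] -/
theorem jacobiChar_natCast_eq_zero_of_dvd {n : ℕ} (h : n ∣ q) (hn : n ≠ 1) :
    jacobiChar q n = 0 := by
  rw [jacobiChar_natCast, Int.cast_eq_zero, jacobiSym.eq_zero_iff_not_coprime,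
    Int.gcd_natCast_natCast, Nat.gcd_eq_left h]
  exact hn

/-- **`jacobiChar q` is a non-trivial character** when `q ≠ 1` is odd and square-free: if
`q = ℓ m` with `ℓ` an odd prime, `ℓ ∤ m`, an integer `n ≡ r (mod ℓ)`, `n ≡ 1 (mod m)` with `r` a
non-residue mod `ℓ` has `J(n | q) = (r / ℓ) · J(1 | m) = −1`. [folklore] -/
theorem jacobiChar_ne_one (hodd : Odd q) (hsq : Squarefree q) (hq1 : q ≠ 1) : jacobiChar q ≠ 1 := by
  -- a prime factor `ℓ` of `q` and the cofactor `m = q / ℓ`, coprime to `ℓ`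
  obtain ⟨ℓ, hℓ, hℓq⟩ := Nat.exists_prime_and_dvd hq1
  set m := q / ℓ with hm
  have hqm : q = ℓ * m := (Nat.mul_div_cancel' hℓq).symm
  have hcop : ℓ.Coprime m :=
    Literature.NumberTheory.LFunctions.PrimitiveQuadratic.coprime_div_of_squarefree hsq hℓ hℓq
  have hℓ0 : ℓ ≠ 0 := hℓ.ne_zero
  have hm0 : m ≠ 0 := fun h => NeZero.ne q (by rw [hqm, h, mul_zero])
  haveI := Fact.mk hℓ
  have hℓ2 : ℓ ≠ 2 := by
    rintro rfl
    exact (Nat.not_even_iff_odd.mpr hodd) (even_iff_two_dvd.mpr hℓq)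
  -- a non-residue `a` mod `ℓ`
  have hchar : ringChar (ZMod ℓ) ≠ 2 := by rwa [ZMod.ringChar_zmod_n]
  obtain ⟨a, ha⟩ := quadraticChar_exists_neg_one hchar
  -- `n ≡ a (mod ℓ)`, `n ≡ 1 (mod m)`
  obtain ⟨n, hn1, hn2⟩ := Nat.chineseRemainder hcop a.val 1
  have hJℓ : J((n : ℤ) | ℓ) = -1 := by
    rw [← jacobiSym_natCast_mod, show n % ℓ = a.val from ?_, ← jacobiSym.legendreSym.to_jacobiSym]
    · rw [legendreSym, Int.cast_natCast, ZMod.natCast_zmod_val]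
      exact ha
    · rw [show n % ℓ = a.val % ℓ from hn1, Nat.mod_eq_of_lt (ZMod.val_lt a)]
  have hJm : J((n : ℤ) | m) = 1 := by
    rw [← jacobiSym_natCast_mod, show n % m = 1 % m from hn2, jacobiSym_natCast_mod, Nat.cast_one,
      jacobiSym.one_left]
  have hJ : jacobiChar q n = -1 := by
    rw [jacobiChar_natCast, hqm, jacobiSym.mul_right' (n : ℤ) hℓ0 hm0, hJℓ, hJm]
    norm_num
  -- but the trivial character takes only the values `0` and `1`
  intro h1
  rw [h1] at hJ
  by_cases hu : IsUnit (n : ZMod q)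
  · obtain ⟨u, hu⟩ := hu
    rw [← hu, MulChar.one_apply_coe] at hJ
    norm_num at hJ
  · rw [MulChar.map_nonunit _ hu] at hJ
    norm_num at hJ

/-! ### The Kronecker symbol of an odd fundamental discriminant is `n ↦ (n / |D|)` -/

/-- **Reciprocity for an odd discriminant**: for `D ≡ 1 (mod 4)` and odd `p`,
`J(p | |D|) = J(D | p)` — the Kronecker symbol `(D / p)` is the Jacobi symbol `(p / |D|)`
(Cox, proof of Lemma 1.14, (1.18); the cases `D = q ≡ 1 (mod 4)`:
`jacobiSym.quadratic_reciprocity_one_mod_four`, and `D = −q`, `q ≡ 3 (mod 4)`: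
`jacobiSym_neg_eq_jacobiSym_of_mod_four` of `LFunctions/PrimitiveQuadraticCharacter.lean`).
[cite: Cox2013, §1.C Lemma 1.14] -/
theorem jacobiSym_natAbs_eq_of_emod_four_eq_one {D : ℤ} (hD : D % 4 = 1) {p : ℕ} (hp : Odd p) :
    J((p : ℤ) | D.natAbs) = J(D | p) := by
  rcases le_or_gt 0 D with h0 | h0
  · -- `D = q ≡ 1 (mod 4)`
    lift D to ℕ using h0
    rw [Int.natAbs_natCast]
    have hD' : D % 4 = 1 := by omega
    exact (jacobiSym.quadratic_reciprocity_one_mod_four hD' hp).symm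
  · -- `D = -q`, `q ≡ 3 (mod 4)`
    set qq := D.natAbs with hqq
    have hDq : D = -(qq : ℤ) := by rw [hqq]; omega
    have hq3 : qq % 4 = 3 := by omega
    rw [hDq]
    exact (Literature.NumberTheory.LFunctions.PrimitiveQuadratic.jacobiSym_neg_eq_jacobiSym_of_mod_four
      hq3 hp).symm

/-- The supplement at `2`: for `D ≡ 1 (mod 4)`, `J(2 | |D|) = 1 ↔ D ≡ 1 (mod 8)`.
[cite: Cox2013, §1.C Lemma 1.14] -/
theorem jacobiSym_two_natAbs_eq_one_iff {D : ℤ} (hD : D % 4 = 1) :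
    J(2 | D.natAbs) = 1 ↔ D % 8 = 1 := by
  have hodd : Odd D.natAbs := by
    rw [Int.natAbs_odd]
    exact Int.odd_iff.mpr (by omega)
  rw [jacobiSym.at_two hodd, ZMod.χ₈_nat_eq_if_mod_eight]
  have h2 : D.natAbs % 2 ≠ 0 := by omega
  simp only [h2, if_false]
  split_ifs with h <;> constructor <;> intro h' <;> first | omega | exact absurd h' (by decide)

/-- The supplement at `2`: for `D ≡ 1 (mod 4)`, `J(2 | |D|) = −1 ↔ D ≡ 5 (mod 8)`.
[cite: Cox2013, §1.C Lemma 1.14] -/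
theorem jacobiSym_two_natAbs_eq_neg_one_iff {D : ℤ} (hD : D % 4 = 1) :
    J(2 | D.natAbs) = -1 ↔ D % 8 = 5 := by
  have hodd : Odd D.natAbs := by
    rw [Int.natAbs_odd]
    exact Int.odd_iff.mpr (by omega)
  rw [jacobiSym.at_two hodd, ZMod.χ₈_nat_eq_if_mod_eight]
  have h2 : D.natAbs % 2 ≠ 0 := by omega
  simp only [h2, if_false]
  split_ifs with h <;> constructor <;> intro h' <;> first | omega | exact absurd h' (by decide)

end Literature.NumberTheory.QuadraticFields
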